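import Literature.NumberTheory.EllipticCurves.IwasawaLayerModuleTwoVarLinear
import Mathlib.RingTheory.Filtration
import Mathlib.RingTheory.PowerSeries.Inverse
import Mathlib.RingTheory.PowerSeries.Ideal
import HarnessLib

/-!
# Rigidity of the `R⟦T₂⟧⟦T₁⟧`-module structure: an additive map into a finitely generated module over a
# Noetherian local ring that intertwines the three generators `T₁`, `T₂`, constants is semilinear

Topic `NumberTheory/IwasawaTheory`; namespace `Literature.NumberTheory.IwasawaTheory`. Pure commutative algebra
(Mathlib-style; nothing about elliptic curves is asserted). THEOREMS ONLY (no `def`, no named fact, no instance,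
no `sorry`). Cell `bsd-print-cf2` (`run/shared/lean/pub/bsd-print-cf2/`), width seat `bsd-line-cf2-p1-w7` g9:
the algebraic heart of the «generator translation» transport ([T3] units half) of the pinned datum `U_∞/𝒞_∞`
(`Literature.NumberTheory.ComplexMultiplication.EllipticUnits.SemilocalUnitData₂`), where two `ℤ_p⟦T₁,T₂⟧`-module
structures on one group of `χ`-coinvariants agree on `T₁`, `T₂`, `ℤ_p` only up to a ring automorphism and ARE
NOT given with any topology. HONEST FRAMING: bookkeeping; BSD is not advanced by this file.

THE POINT. Let `Λ₂ = R⟦T₂⟧⟦T₁⟧` (`T₁ = X` outer, `T₂ = C X` inner, constants `C (C c)`), `Λ` a Noetherian local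
ring, `σ : Λ₂ →+* Λ` a ring map with `σ T₁, σ T₂ ∈ 𝔪_Λ`, `M` a `Λ₂`-module, `N` a FINITELY GENERATED `Λ`-module and
`Θ : M →+ N` additive with `Θ (T₁•m) = σ T₁ • Θ m`, `Θ (T₂•m) = σ T₂ • Θ m`, `Θ (c•m) = σ c • Θ m` (`c` constant).
Then **`Θ (f • m) = σ f • Θ m` for EVERY power series `f`** (`map_smul_of_map_generators`) — no continuity
hypothesis is needed: the `f` with this property form a subsemiring containing the polynomials; writing
`f = P + T₁ⁿ A + T₂ⁿ B` (double truncation, the tree's `IwasawaDual.exists_eq_poly_add_X_pow_mul_add`) gives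
`Θ (f•m) − σ f • Θ m = (σ T₁)ⁿ • (Θ (A•m) − σ A • Θ m) + (σ T₂)ⁿ • (…) ∈ 𝔪_Λⁿ N` for every `n`, and
`⋂ₙ 𝔪_Λⁿ N = 0` by KRULL'S INTERSECTION THEOREM (Mathlib `Ideal.iInf_pow_smul_eq_bot_of_isLocalRing`).
Corollaries: the case of a ring AUTOMORPHISM `σ` of `Λ₂` over a Noetherian local `R` (`σ Tᵢ ∈ 𝔪` is automatic:
`map_smul_of_map_generators_ringEquiv`), and the transfers of finite generation / torsion / the inverse law
along an additive ISOMORPHISM (`…_addEquiv_symm`).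

References: N. Bourbaki, *Algèbre commutative* III §3 no. 2 (Krull's intersection theorem) and VII §4.5
[BourbakiAC5to7]; S. Lang, *Cyclotomic Fields I–II*, Ch. 5 §1 (the `Λ`-module structure through `T ↦ γ − 1`)
[Lang1990]; H. Matsumura, *Commutative Ring Theory*, Thm. 8.10 [Matsumura1987].
-/

noncomputable section

set_option autoImplicit false

open PowerSeries IsLocalRing

namespace Literature.NumberTheory.IwasawaTheory

open Literature.NumberTheory.EllipticCurves.IwasawaDual

/-! ## §1. The general rigidity statement (target finitely generated over a Noetherian local ring) -/

section General

variable {R : Type*} [CommRing R] {Λ : Type*} [CommRing Λ]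
  {M : Type*} [AddCommGroup M] [Module (PowerSeries (PowerSeries R)) M]
  {N : Type*} [AddCommGroup N] [Module Λ N]
  (σ : PowerSeries (PowerSeries R) →+* Λ) (Θ : M →+ N)
  (h₁ : ∀ m : M, Θ ((X : PowerSeries (PowerSeries R)) • m) = σ X • Θ m)
  (h₂ : ∀ m : M, Θ ((C X : PowerSeries (PowerSeries R)) • m) = σ (C X) • Θ m)
  (h₃ : ∀ (c : R) (m : M), Θ ((C (C c) : PowerSeries (PowerSeries R)) • m) = σ (C (C c)) • Θ m)

include h₁ h₂ h₃ in
/-- **The polynomial part**: `Θ (f • m) = σ f • Θ m` for every `f` in the subsemiring generated by `T₁ = X`,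
`T₂ = C X` and the constants — in particular for the double truncations
`∑_{i<n} ∑_{j<n} c_{ij} T₂^j T₁^i` and for `T₁ⁿ`, `T₂ⁿ`. Stated as: the set of such `f` is a subsemiring containing
the three kinds of generators (closure form). [cite: Lang1990, Ch. 5 §1] -/
theorem map_smul_of_mem_closure {f : PowerSeries (PowerSeries R)}
    (hf : f ∈ Subsemiring.closure
      ({X, C X} ∪ Set.range (fun c : R ↦ (C (C c) : PowerSeries (PowerSeries R))))) (m : M) :
    Θ (f • m) = σ f • Θ m := by
  induction hf using Subsemiring.closure_induction generalizing m with
  | mem x hx =>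
    rcases hx with hx | ⟨c, rfl⟩
    · rcases hx with rfl | rfl
      · exact h₁ m
      · exact h₂ m
    · exact h₃ c m
  | zero => rw [zero_smul, map_zero, map_zero, zero_smul]
  | one => rw [one_smul, map_one, one_smul]
  | add x y _ _ hx hy => rw [add_smul, map_add, hx, hy, map_add, add_smul]
  | mul x y _ _ hx hy => rw [mul_smul, hx, hy, map_mul, mul_smul]

include h₁ h₂ h₃ in
/-- **The error of semilinearity is `𝔪ⁿ`-small for every `n`** (when `σ T₁, σ T₂ ∈ 𝔪_Λ`): by the double truncation
`f = P + T₁ⁿ A + T₂ⁿ B`, `Θ (f•m) − σ f • Θ m = (σT₁)ⁿ•(Θ(A•m) − σA•Θm) + (σT₂)ⁿ•(Θ(B•m) − σB•Θm) ∈ 𝔪_Λⁿ N`.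
[cite: Lang1990, Ch. 5 §1] [cite: BourbakiAC5to7, III §3 no. 2] -/
theorem map_smul_sub_mem_pow_smul [IsLocalRing Λ] (hσ₁ : σ X ∈ maximalIdeal Λ) (hσ₂ : σ (C X) ∈ maximalIdeal Λ)
    (f : PowerSeries (PowerSeries R)) (m : M) (n : ℕ) :
    Θ (f • m) - σ f • Θ m ∈ (maximalIdeal Λ) ^ n • (⊤ : Submodule Λ N) := by
  -- the subsemiring of generators
  set G := Subsemiring.closure
      ({X, C X} ∪ Set.range (fun c : R ↦ (C (C c) : PowerSeries (PowerSeries R)))) with hGdef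
  have hX : (X : PowerSeries (PowerSeries R)) ∈ G := Subsemiring.subset_closure (Or.inl (Or.inl rfl))
  have hCX : (C X : PowerSeries (PowerSeries R)) ∈ G := Subsemiring.subset_closure (Or.inl (Or.inr rfl))
  have hCC : ∀ c : R, (C (C c) : PowerSeries (PowerSeries R)) ∈ G := fun c ↦
    Subsemiring.subset_closure (Or.inr ⟨c, rfl⟩)
  obtain ⟨A, B, hf⟩ := exists_eq_poly_add_X_pow_mul_add f n
  have hP : (∑ i ∈ Finset.range n, ∑ j ∈ Finset.range n,
      C (C (coeff j (coeff i f))) * (C X) ^ j * X ^ i : PowerSeries (PowerSeries R)) ∈ G :=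
    Subsemiring.sum_mem _ fun i _ ↦ Subsemiring.sum_mem _ fun j _ ↦
      Subsemiring.mul_mem _ (Subsemiring.mul_mem _ (hCC _) (Subsemiring.pow_mem _ hCX _))
        (Subsemiring.pow_mem _ hX _)
  -- the two remainders are `𝔪ⁿ`-small
  have hrem : ∀ (y : PowerSeries (PowerSeries R)) (hy : y ∈ G) (hyσ : σ y ∈ (maximalIdeal Λ) ^ n)
      (A : PowerSeries (PowerSeries R)),
      Θ ((y * A) • m) - σ (y * A) • Θ m ∈ (maximalIdeal Λ) ^ n • (⊤ : Submodule Λ N) := by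
    intro y hy hyσ A
    rw [mul_smul, map_smul_of_mem_closure σ Θ h₁ h₂ h₃ hy, map_mul, mul_smul, ← smul_sub]
    exact Submodule.smul_mem_smul hyσ Submodule.mem_top
  have hsplit : Θ (f • m) - σ f • Θ m =
      (Θ ((X ^ n * A) • m) - σ (X ^ n * A) • Θ m) + (Θ (((C X) ^ n * B) • m) - σ ((C X) ^ n * B) • Θ m) := by
    conv_lhs => rw [hf]
    rw [add_smul, add_smul, map_add, map_add, map_add, map_add, add_smul, add_smul,
      map_smul_of_mem_closure σ Θ h₁ h₂ h₃ hP]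
    abel
  rw [hsplit]
  refine Submodule.add_mem _ (hrem _ (Subsemiring.pow_mem _ hX n) ?_ A)
    (hrem _ (Subsemiring.pow_mem _ hCX n) ?_ B)
  · rw [map_pow]; exact Ideal.pow_mem_pow hσ₁ n
  · rw [map_pow]; exact Ideal.pow_mem_pow hσ₂ n

include h₁ h₂ h₃ in
/-- **RIGIDITY: an additive map into a FINITELY GENERATED module over a Noetherian local ring that intertwines
`T₁`, `T₂` and the constants through `σ` (`σ T₁, σ T₂ ∈ 𝔪_Λ`) is `σ`-SEMILINEAR** — `Θ (f • m) = σ f • Θ m` for every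
power series `f`, without any continuity hypothesis: the error lies in `⋂ₙ 𝔪_Λⁿ N = 0` (Krull's intersection theorem).
[cite: BourbakiAC5to7, III §3 no. 2 (Krull) and VII §4.5] [cite: Lang1990, Ch. 5 §1] -/
theorem map_smul_of_map_generators [IsNoetherianRing Λ] [IsLocalRing Λ] [Module.Finite Λ N]
    (hσ₁ : σ X ∈ maximalIdeal Λ) (hσ₂ : σ (C X) ∈ maximalIdeal Λ) (f : PowerSeries (PowerSeries R)) (m : M) :
    Θ (f • m) = σ f • Θ m := by
  rw [← sub_eq_zero, ← Submodule.mem_bot Λ,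
    ← Ideal.iInf_pow_smul_eq_bot_of_isLocalRing (M := N) (maximalIdeal Λ) (maximalIdeal.isMaximal Λ).ne_top,
    Submodule.mem_iInf]
  exact fun n ↦ map_smul_sub_mem_pow_smul σ Θ h₁ h₂ h₃ hσ₁ hσ₂ f m n

end General

/-! ## §2. Ring automorphisms of `R⟦T₂⟧⟦T₁⟧` over a Noetherian local `R` -/

section Equiv

variable {R : Type*} [CommRing R] [IsLocalRing R]

/-- `T₁ = X` lies in the maximal ideal of the local ring `R⟦T₂⟧⟦T₁⟧` (its constant term is `0`). [folklore] -/
private theorem X_mem_maximalIdeal : (X : PowerSeries (PowerSeries R)) ∈ maximalIdeal (PowerSeries (PowerSeries R)) := by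
  rw [mem_maximalIdeal, mem_nonunits_iff, isUnit_iff_constantCoeff, constantCoeff_X]
  exact not_isUnit_zero

/-- `T₂ = C X` lies in the maximal ideal of `R⟦T₂⟧⟦T₁⟧` (its constant term `X ∈ R⟦T₂⟧` is not a unit). [folklore] -/
private theorem C_X_mem_maximalIdeal : (C X : PowerSeries (PowerSeries R)) ∈ maximalIdeal (PowerSeries (PowerSeries R)) := by
  rw [mem_maximalIdeal, mem_nonunits_iff, isUnit_iff_constantCoeff, constantCoeff_C, isUnit_iff_constantCoeff,
    constantCoeff_X]
  exact not_isUnit_zero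

/-- A ring automorphism of a local ring maps the maximal ideal into itself. [folklore] -/
private theorem map_mem_maximalIdeal_of_ringEquiv {S : Type*} [CommRing S] [IsLocalRing S] (σ : S ≃+* S) {x : S}
    (hx : x ∈ maximalIdeal S) : σ x ∈ maximalIdeal S := by
  rw [mem_maximalIdeal, mem_nonunits_iff] at hx ⊢
  intro h
  apply hx
  have h' := h.map σ.symm
  rwa [RingEquiv.symm_apply_apply] at h'

variable {M : Type*} [AddCommGroup M] [Module (PowerSeries (PowerSeries R)) M]
  {N : Type*} [AddCommGroup N] [Module (PowerSeries (PowerSeries R)) N]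
  (σ : PowerSeries (PowerSeries R) ≃+* PowerSeries (PowerSeries R))

/-- **RIGIDITY FOR A RING AUTOMORPHISM `σ` of `Λ₂ = R⟦T₂⟧⟦T₁⟧` (`R` Noetherian local)**: an additive map
`Θ : M → N` into a finitely generated `Λ₂`-module with `Θ (T₁•m) = σT₁ • Θm`, `Θ (T₂•m) = σT₂ • Θm`,
`Θ (c•m) = σ c • Θm` is `σ`-semilinear. [cite: BourbakiAC5to7, III §3 no. 2 and VII §4.5] [cite: Lang1990, Ch. 5 §1] -/
theorem map_smul_of_map_generators_ringEquiv [IsNoetherianRing R]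
    [Module.Finite (PowerSeries (PowerSeries R)) N] (Θ : M →+ N)
    (h₁ : ∀ m : M, Θ ((X : PowerSeries (PowerSeries R)) • m) = σ X • Θ m)
    (h₂ : ∀ m : M, Θ ((C X : PowerSeries (PowerSeries R)) • m) = σ (C X) • Θ m)
    (h₃ : ∀ (c : R) (m : M), Θ ((C (C c) : PowerSeries (PowerSeries R)) • m) = σ (C (C c)) • Θ m)
    (f : PowerSeries (PowerSeries R)) (m : M) :
    Θ (f • m) = σ f • Θ m :=
  map_smul_of_map_generators (σ : PowerSeries (PowerSeries R) →+* PowerSeries (PowerSeries R)) Θ h₁ h₂ h₃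
    (map_mem_maximalIdeal_of_ringEquiv σ X_mem_maximalIdeal)
    (map_mem_maximalIdeal_of_ringEquiv σ C_X_mem_maximalIdeal) f m

/-- **The inverse law along an additive ISOMORPHISM**: if `e : M ≃+ N` is `σ`-semilinear then `e⁻¹` is
`σ⁻¹`-semilinear (no finiteness needed for this direction change). [cite: BourbakiAC5to7, VII §4.5] -/
theorem addEquiv_symm_map_smul {S S' : Type*} [CommRing S] [CommRing S'] (τ : S ≃+* S')
    {A : Type*} [AddCommGroup A] [Module S A] {B : Type*} [AddCommGroup B] [Module S' B] (e : A ≃+ B)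
    (he : ∀ (r : S) (a : A), e (r • a) = τ r • e a) (r : S') (b : B) :
    e.symm (r • b) = τ.symm r • e.symm b := by
  apply e.injective
  rw [AddEquiv.apply_symm_apply, he, RingEquiv.apply_symm_apply, AddEquiv.apply_symm_apply]

omit [IsLocalRing R] in
/-- **The inverse of an additive isomorphism with the generator laws has the generator law at every `g` whose
`σ⁻¹ g` is a POLYNOMIAL in the generators** (e.g. `σ⁻¹ T₁ = w⁻¹(1 + T₁) − 1` for a unit twist):
`e⁻¹ (g • n) = σ⁻¹ g • e⁻¹ n`.
[cite: BourbakiAC5to7, VII §4.5] [cite: Lang1990, Ch. 5 §1] -/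
theorem addEquiv_symm_map_smul_of_mem_closure (e : M ≃+ N)
    (h₁ : ∀ m : M, e ((X : PowerSeries (PowerSeries R)) • m) = σ X • e m)
    (h₂ : ∀ m : M, e ((C X : PowerSeries (PowerSeries R)) • m) = σ (C X) • e m)
    (h₃ : ∀ (c : R) (m : M), e ((C (C c) : PowerSeries (PowerSeries R)) • m) = σ (C (C c)) • e m)
    {g : PowerSeries (PowerSeries R)}
    (hg : σ.symm g ∈ Subsemiring.closure
      ({X, C X} ∪ Set.range (fun c : R ↦ (C (C c) : PowerSeries (PowerSeries R))))) (n : N) :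
    e.symm (g • n) = σ.symm g • e.symm n := by
  have h := map_smul_of_mem_closure (σ : PowerSeries (PowerSeries R) →+* PowerSeries (PowerSeries R))
    e.toAddMonoidHom h₁ h₂ h₃ hg (e.symm n)
  simp only [AddEquiv.coe_toAddMonoidHom, RingHom.coe_coe, RingEquiv.apply_symm_apply,
    AddEquiv.apply_symm_apply] at h
  apply e.injective
  rw [AddEquiv.apply_symm_apply]
  exact h.symm

/-- **RIGIDITY FOR AN ADDITIVE ISOMORPHISM, finiteness on the SOURCE side**: `e : M ≃+ N` intertwining the
generators through `σ`, with `M` finitely generated and `σ⁻¹ T₁, σ⁻¹ T₂, σ⁻¹ c` polynomials in the generators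
(so that `e⁻¹` has the generator laws for `σ⁻¹`), is `σ`-semilinear: the theorem for `e⁻¹`, inverted.
[cite: BourbakiAC5to7, III §3 no. 2 and VII §4.5] [cite: Lang1990, Ch. 5 §1] -/
theorem addEquiv_map_smul_of_map_generators_of_finite_source [IsNoetherianRing R]
    [Module.Finite (PowerSeries (PowerSeries R)) M]
    (e : M ≃+ N)
    (h₁ : ∀ m : M, e ((X : PowerSeries (PowerSeries R)) • m) = σ X • e m)
    (h₂ : ∀ m : M, e ((C X : PowerSeries (PowerSeries R)) • m) = σ (C X) • e m)
    (h₃ : ∀ (c : R) (m : M), e ((C (C c) : PowerSeries (PowerSeries R)) • m) = σ (C (C c)) • e m)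
    (k₁ : σ.symm X ∈ Subsemiring.closure
      ({X, C X} ∪ Set.range (fun c : R ↦ (C (C c) : PowerSeries (PowerSeries R)))))
    (k₂ : σ.symm (C X) ∈ Subsemiring.closure
      ({X, C X} ∪ Set.range (fun c : R ↦ (C (C c) : PowerSeries (PowerSeries R)))))
    (k₃ : ∀ c : R, σ.symm (C (C c)) ∈ Subsemiring.closure
      ({X, C X} ∪ Set.range (fun c : R ↦ (C (C c) : PowerSeries (PowerSeries R)))))
    (f : PowerSeries (PowerSeries R)) (m : M) :
    e (f • m) = σ f • e m := by
  have hsymm : ∀ (g : PowerSeries (PowerSeries R)) (n : N), e.symm (g • n) = σ.symm g • e.symm n :=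
    map_smul_of_map_generators_ringEquiv σ.symm e.symm.toAddMonoidHom
      (fun n ↦ addEquiv_symm_map_smul_of_mem_closure σ e h₁ h₂ h₃ k₁ n)
      (fun n ↦ addEquiv_symm_map_smul_of_mem_closure σ e h₁ h₂ h₃ k₂ n)
      (fun c n ↦ addEquiv_symm_map_smul_of_mem_closure σ e h₁ h₂ h₃ (k₃ c) n)
  have h := addEquiv_symm_map_smul σ.symm e.symm hsymm f m
  rwa [AddEquiv.symm_symm, RingEquiv.symm_symm] at h

end Equiv

end Literature.NumberTheory.IwasawaTheory

end
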